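import Summits.HubbardSuperconductivity.HubbardSuperconductivity.Theorems.WeakCouplingBCSDefsKlCertTPrime
import Summits.HubbardSuperconductivity.HubbardSuperconductivity.Theorems.WeakCouplingBCSKlPinchOrder
import Summits.HubbardSuperconductivity.HubbardSuperconductivity.Theorems.WeakCouplingBCSKlCertTPrimePHReflection

/-!
# The «van Hove PEAK leaf» for the `t`–`t′` Kohn–Luttinger margin scan (KL-MARGIN-SCAN HQ1 (ii)/(iii), dual reading)

Reader seat hubbard-klscan-idea-3 (lens: dual certificates / obstruction reading), round 6; bears on the certificate half of
`Theses.WeakCouplingBCS.WcbcsKohnLuttingerB1g` (stmt-HubbardSuperconductivity-0158).  HONEST FRAMING: a Kohn–Luttinger `O(U²)` channel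
statement is not ODLRO and nothing here proves superconductivity in the Hubbard model; NO margin at any `t′ ≠ 0` is asserted; nothing is
said about `K₃`, `U₀`, the onset window.  This file contains NO numerical record: it fixes the SHAPE of a three-cell certificate and PROVES
that the shape decides NON-monotonicity — the negative answer to HQ1 (ii) «is the margin monotone in `δ` at fixed `t′`?» (float: at every
`t′ < 0` of the grid it is not — the van Hove peak) and the shape of the (iii) line `δ = ⅛` (float: a peak in `t′`, no sign change).

THE DUAL READING.  Certified MONOTONICITY of `m` along a grid needs a two-sided word at every cell, narrower than the adjacent differences
(SCAN-TABLE v0 §0 (ii); `KlPinchOrder` is the cheapest known device, `t′ = 0`).  Certified NON-monotonicity needs much less: an interior cell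
whose FLOOR beats the CEILINGS of two cells on either side.  The floor is what a standard SELECTION record already delivers
(`KLB1gDominatesAtTP tp a b γ`: `B1g` Ritz ceiling + rival floors ⇒ `γ ≤ m` on the box).  The ceiling is delivered by the DUAL one-sided
record — the roles swapped: ONE rival Rayleigh CEILING (`KLRivalCeilingAtTP`, one explicit trial state in sector `χ`) plus ONE `B1g` FLOOR
(`KLB1gFloorAtTP`; intended source: the gap-free Schatten/Hilbert–Schmidt bound `λ_B1g ≥ −‖K̂ᴮ‖_{S_p}` of `KlPinchOrder.SchattenCeiling`,
or a Temple bound) ⇒ `m ≤ r − l` on the box (`rivalMarginTP_le_of_dual`).  No two-sided bracket of anything is ever formed.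

* §1 `rivalMarginTP tp μ := min(λ_A2g, λ_B2g, λ_E) − λ_B1g` for `ε_{t′}` at `U = 1` — the `t′` twin of the tree's `KlNotB1g.rivalMargin`
  (`rivalMarginTP_zero : rivalMarginTP 0 = rivalMargin`, `rfl`); floor from the standard conclusion (`rivalMarginTP_ge_of_dominates`).
* §2 the dual window records `KLRivalCeilingAtTP`, `KLB1gFloorAtTP`, `KLB1gCeilingAtTP` and the margin ceiling `rivalMarginTP_le_of_dual`;
  `t′ = 0` bridges from `KlPinchOrder.SchattenCeiling` / `RayleighFloor` (`b1gFloorAtTP_zero_of_schattenCeiling`, `b1gCeilingAtTP_zero_of_rayleighFloor`);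
  particle–hole ⊗ `(π, π)` reflection of each dual record (`…_of_ph_reflection`, from the landed `channelInf_ph_reflection`): an `M`-centred
  cell `(t′, [a, b])` is served by the `Γ`-centred cell `(−t′, [−b, −a])` verbatim, exactly as for `KLB1gDominatesAtTP`.
* §3 the peak predicate `MarginPeakTP tp μ₁ μ₂ μ₃ g` (`m(μ₁) + g ≤ m(μ₂)` and `m(μ₃) + g ≤ m(μ₂)`) and its SOUNDNESS from one selection conclusion
  at the middle box and two dual records at the outer boxes (`marginPeakTP_of_records`); the same along a line of varying `t′` at fixed doping
  (`lineMarginTP`, `LinePeakTP`, `linePeakTP_of_records`).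
* §4 what a peak decides: a strict interior peak of any real function excludes `MonotoneOn` AND `AntitoneOn` on every set containing the three
  abscissae (`not_monotoneOn_of_peak`, `not_antitoneOn_of_peak`); instantiated in the doping coordinate (`hq1ii_negative_of_marginPeak`) and along
  the `t′` line (`hq1iii_shape_of_linePeak`).  What it does NOT decide (docstring of `hq1iii_shape_of_linePeak`): sign changes BETWEEN audited cells.
* §5 the `λ_B1g`-only twin («van Hove enhancement of the `d`-wave coupling at second order»): `B1gDipTP` from one `B1g` Ritz ceiling at the middle
  box and two `B1g` floors at the outer boxes — no rival data at all (`b1gDipTP_of_records`, `dwaveCoupling_not_monotone_of_dip`).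
* §6 the three named TARGET ROWS of the scan (statements only, nothing claimed): `MarginPeakRow_tm02` (`t′ = −1/5`, `δ = 1/20, 1/8, 7/20`),
  `MarginPeakLine_d0125` (`δ = 1/8`, `t′ = 0, −1/5, −3/10`) and `MarginPeakLine_d0125_tm01` (middle node `−1/10`), `B1gDipRow_tm02`; and their readings
  `hq1ii_tm02_of_row`, `hq1iii_d0125_of_line`, `hq1iii_d0125_of_line_tm01`.

References: S. Raghu, S. A. Kivelson, D. J. Scalapino, Phys. Rev. B 81 (2010) 224505, §III and Fig. 3 (the `t′ ≠ 0` channel picture);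
W. Kohn, J. M. Luttinger, Phys. Rev. Lett. 15 (1965) 524; B. Simon, *Trace Ideals and Their Applications* (2nd ed., AMS 2005) §1–2
(`‖A‖ ≤ ‖A‖_p`); M. Reed, B. Simon, *Methods of Modern Mathematical Physics IV*, Thm XIII.1–XIII.2 (Rayleigh–Ritz).
-/

noncomputable section

-- the tree's namespace convention repeats the summit name by design (D-0017)
set_option linter.dupNamespace false

open Set
open Literature.MathematicalPhysics.QuantumLattice
open Summit.HubbardSuperconductivity.HubbardSuperconductivity.Theorems
open Summit.HubbardSuperconductivity.HubbardSuperconductivity.Theorems.KlNotB1g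

namespace Summit.HubbardSuperconductivity.HubbardSuperconductivity.Theorems.KlVHPeak

/-! ## §1  The `t′`-parametrised rival margin and its floor from a selection conclusion -/

/-- The rival margin of the `t`–`t′` band at `U = 1`: `m(μ; t′) := min(λ_A2g, λ_B2g, λ_E)(μ) − λ_B1g(μ)`,
`λ_χ(μ) = channelInf ε_{t′} μ 1 χ`, `ε_{t′} = squareDispersion 1 tp`.  The `t′` twin of `KlNotB1g.rivalMargin`. -/
def rivalMarginTP (tp μ : ℝ) : ℝ :=
  min (min (channelInf (squareDispersion 1 tp) μ 1 D4Irrep.A2g) (channelInf (squareDispersion 1 tp) μ 1 D4Irrep.B2g))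
      (channelInf (squareDispersion 1 tp) μ 1 D4Irrep.E) - channelInf (squareDispersion 1 tp) μ 1 D4Irrep.B1g

/-- **Reduction at `t′ = 0`**: the parametrised rival margin IS the tree's `KlNotB1g.rivalMargin`. -/
theorem rivalMarginTP_zero : rivalMarginTP 0 = rivalMargin := rfl

/-- `m(μ; t′) ≤ λ_χ(μ) − λ_B1g(μ)` for every rival `χ ∈ {A2g, B2g, E}`. -/
theorem rivalMarginTP_le (tp μ : ℝ) {χ : D4Irrep} (hχ : IsRival χ) :
    rivalMarginTP tp μ ≤ channelInf (squareDispersion 1 tp) μ 1 χ - channelInf (squareDispersion 1 tp) μ 1 D4Irrep.B1g := by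
  rcases (isRival_iff χ).1 hχ with rfl | rfl | rfl <;> unfold rivalMarginTP <;> gcongr
  · exact (min_le_left _ _).trans (min_le_left _ _)
  · exact (min_le_left _ _).trans (min_le_right _ _)
  · exact min_le_right _ _

/-- **Floor from the standard conclusion.**  A certified selection row `KLB1gDominatesAtTP tp a b γ` (the shape margin-1's cell
certificate concludes) gives `γ ≤ m(μ; t′)` at every `μ` of its box. -/
theorem rivalMarginTP_ge_of_dominates {tp a b γ μ : ℝ} (h : KLB1gDominatesAtTP tp a b γ) (hμ : μ ∈ Icc a b) :
    γ ≤ rivalMarginTP tp μ := by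
  have hA := h μ hμ D4Irrep.A2g (by decide)
  have hB := h μ hμ D4Irrep.B2g (by decide)
  have hE := h μ hμ D4Irrep.E (by decide)
  unfold rivalMarginTP
  have h1 : channelInf (squareDispersion 1 tp) μ 1 D4Irrep.B1g + γ ≤
      min (min (channelInf (squareDispersion 1 tp) μ 1 D4Irrep.A2g) (channelInf (squareDispersion 1 tp) μ 1 D4Irrep.B2g))
        (channelInf (squareDispersion 1 tp) μ 1 D4Irrep.E) := le_min (le_min hA hB) hE
  linarith

/-! ## §2  The DUAL one-sided window records (roles swapped) and the margin ceiling -/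

/-- **Rival Rayleigh ceiling on a box**: `λ_χ(μ) ≤ r` for all `μ ∈ [a, b]` (intended source: the Rayleigh quotient of ONE explicit
trial state of symmetry `χ`, `channelInf ≤` it by definition of the infimum). [folklore] -/
def KLRivalCeilingAtTP (tp a b : ℝ) (χ : D4Irrep) (r : ℝ) : Prop :=
  ∀ μ ∈ Icc a b, channelInf (squareDispersion 1 tp) μ 1 χ ≤ r

/-- **`B1g` floor on a box**: `l ≤ λ_B1g(μ)` for all `μ ∈ [a, b]` (intended sources: the gap-free Schatten bound `λ_B1g ≥ −‖K̂ᴮ_μ‖_{S_p}`,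
`p = 2` a double integral, `p = 4` a fourfold one — `KlPinchOrder.SchattenCeiling` at `t′ = 0` —, or a Temple bound). [folklore] -/
def KLB1gFloorAtTP (tp a b l : ℝ) : Prop :=
  ∀ μ ∈ Icc a b, l ≤ channelInf (squareDispersion 1 tp) μ 1 D4Irrep.B1g

/-- **`B1g` ceiling on a box**: `λ_B1g(μ) ≤ u` for all `μ ∈ [a, b]` (source: the `B1g` Ritz value of a selection record, E1–E2 of
`KLBlock.RitzEnclosureTP`). [folklore] -/
def KLB1gCeilingAtTP (tp a b u : ℝ) : Prop :=
  ∀ μ ∈ Icc a b, channelInf (squareDispersion 1 tp) μ 1 D4Irrep.B1g ≤ u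

/-- **Margin CEILING from a dual record (PROVED).**  One rival ceiling `r` and one `B1g` floor `l` on the same box give `m ≤ r − l` there. -/
theorem rivalMarginTP_le_of_dual {tp a b r l μ : ℝ} {χ : D4Irrep} (hχ : IsRival χ)
    (hr : KLRivalCeilingAtTP tp a b χ r) (hl : KLB1gFloorAtTP tp a b l) (hμ : μ ∈ Icc a b) :
    rivalMarginTP tp μ ≤ r - l := by
  have h1 := rivalMarginTP_le tp μ hχ
  have h2 := hr μ hμ
  have h3 := hl μ hμ
  linarith

/-- **`t′ = 0` bridge**: a `KlPinchOrder.SchattenCeiling μ S` (`−λ_B1g(μ) ≤ S`) IS a `B1g` floor `−S` on the degenerate box `[μ, μ]`. -/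
theorem b1gFloorAtTP_zero_of_schattenCeiling {μ S : ℝ} (h : KlPinchOrder.SchattenCeiling μ S) :
    KLB1gFloorAtTP 0 μ μ (-S) := by
  intro ν hν
  have hνμ : ν = μ := le_antisymm hν.2 hν.1
  subst hνμ
  unfold KlPinchOrder.SchattenCeiling at h
  linarith

/-- **`t′ = 0` bridge**: a `KlPinchOrder.RayleighFloor μ R` (`R ≤ −λ_B1g(μ)`) IS a `B1g` ceiling `−R` on the degenerate box `[μ, μ]`. -/
theorem b1gCeilingAtTP_zero_of_rayleighFloor {μ R : ℝ} (h : KlPinchOrder.RayleighFloor μ R) :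
    KLB1gCeilingAtTP 0 μ μ (-R) := by
  intro ν hν
  have hνμ : ν = μ := le_antisymm hν.2 hν.1
  subst hνμ
  unfold KlPinchOrder.RayleighFloor at h
  linarith

/-- **PH reflection of a rival ceiling**: the record for the `Γ`-centred cell `(−t′, [−b, −a])` IS the record for `(t′, [a, b])`
(`channelInf_ph_reflection`). -/
theorem klRivalCeilingAtTP_of_ph_reflection {tp a b r : ℝ} {χ : D4Irrep} (h : KLRivalCeilingAtTP (-tp) (-b) (-a) χ r) :
    KLRivalCeilingAtTP tp a b χ r := by
  intro μ hμ
  have hμ' : -μ ∈ Icc (-b) (-a) := ⟨neg_le_neg hμ.2, neg_le_neg hμ.1⟩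
  have h' := h (-μ) hμ'
  rwa [← channelInf_ph_reflection tp μ 1 χ] at h'

/-- **PH reflection of a `B1g` floor** (`channelInf_ph_reflection`). -/
theorem klB1gFloorAtTP_of_ph_reflection {tp a b l : ℝ} (h : KLB1gFloorAtTP (-tp) (-b) (-a) l) :
    KLB1gFloorAtTP tp a b l := by
  intro μ hμ
  have hμ' : -μ ∈ Icc (-b) (-a) := ⟨neg_le_neg hμ.2, neg_le_neg hμ.1⟩
  have h' := h (-μ) hμ'
  rwa [← channelInf_ph_reflection tp μ 1 D4Irrep.B1g] at h'

/-- **PH reflection of a `B1g` ceiling** (`channelInf_ph_reflection`). -/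
theorem klB1gCeilingAtTP_of_ph_reflection {tp a b u : ℝ} (h : KLB1gCeilingAtTP (-tp) (-b) (-a) u) :
    KLB1gCeilingAtTP tp a b u := by
  intro μ hμ
  have hμ' : -μ ∈ Icc (-b) (-a) := ⟨neg_le_neg hμ.2, neg_le_neg hμ.1⟩
  have h' := h (-μ) hμ'
  rwa [← channelInf_ph_reflection tp μ 1 D4Irrep.B1g] at h'

/-! ## §3  The peak predicate and its soundness from ONE selection conclusion + TWO dual records -/

/-- **Interior peak of the margin at hopping `t′`**: the margin at the middle level `μ₂` exceeds the margins at `μ₁` and at `μ₃` by `g`. [folklore] -/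
def MarginPeakTP (tp μ₁ μ₂ μ₃ g : ℝ) : Prop :=
  rivalMarginTP tp μ₁ + g ≤ rivalMarginTP tp μ₂ ∧ rivalMarginTP tp μ₃ + g ≤ rivalMarginTP tp μ₂

/-- **Soundness of the peak leaf (PROVED).**  A selection conclusion `γ₂` on a box containing `μ₂`, dual records `(χ₁; r₁, l₁)` and
`(χ₃; r₃, l₃)` on boxes containing `μ₁` and `μ₃`, and the two rational checks `r₁ − l₁ + g ≤ γ₂`, `r₃ − l₃ + g ≤ γ₂` certify the peak. -/
theorem marginPeakTP_of_records {tp μ₁ μ₂ μ₃ g a₁ b₁ a₂ b₂ a₃ b₃ γ₂ r₁ l₁ r₃ l₃ : ℝ} {χ₁ χ₃ : D4Irrep}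
    (hmid : KLB1gDominatesAtTP tp a₂ b₂ γ₂) (hμ₂ : μ₂ ∈ Icc a₂ b₂)
    (hχ₁ : IsRival χ₁) (hr₁ : KLRivalCeilingAtTP tp a₁ b₁ χ₁ r₁) (hl₁ : KLB1gFloorAtTP tp a₁ b₁ l₁) (hμ₁ : μ₁ ∈ Icc a₁ b₁)
    (hχ₃ : IsRival χ₃) (hr₃ : KLRivalCeilingAtTP tp a₃ b₃ χ₃ r₃) (hl₃ : KLB1gFloorAtTP tp a₃ b₃ l₃) (hμ₃ : μ₃ ∈ Icc a₃ b₃)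
    (hc₁ : r₁ - l₁ + g ≤ γ₂) (hc₃ : r₃ - l₃ + g ≤ γ₂) :
    MarginPeakTP tp μ₁ μ₂ μ₃ g := by
  have h2 := rivalMarginTP_ge_of_dominates hmid hμ₂
  have h1 := rivalMarginTP_le_of_dual hχ₁ hr₁ hl₁ hμ₁
  have h3 := rivalMarginTP_le_of_dual hχ₃ hr₃ hl₃ hμ₃
  exact ⟨by linarith, by linarith⟩

/-- The margin along a line of fixed hole doping `δ` and varying hopping `t′`: `t′ ↦ m(μ(δ; t′); t′)`. -/
def lineMarginTP (δ tp : ℝ) : ℝ := rivalMarginTP tp (klMuOfDopingTP tp δ)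

/-- **Interior peak along the `t′` line at doping `δ`**: the margin at `t₂` exceeds the margins at `t₁` and `t₃` by `g`. [folklore] -/
def LinePeakTP (δ t₁ t₂ t₃ g : ℝ) : Prop :=
  lineMarginTP δ t₁ + g ≤ lineMarginTP δ t₂ ∧ lineMarginTP δ t₃ + g ≤ lineMarginTP δ t₂

/-- **Soundness of the line-peak leaf (PROVED)**: the same three records, now at three different hoppings, each box containing the
(certified bracket of the) chemical potential `μ(δ; tᵢ)`. -/
theorem linePeakTP_of_records {δ t₁ t₂ t₃ g a₁ b₁ a₂ b₂ a₃ b₃ γ₂ r₁ l₁ r₃ l₃ : ℝ} {χ₁ χ₃ : D4Irrep}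
    (hmid : KLB1gDominatesAtTP t₂ a₂ b₂ γ₂) (hμ₂ : klMuOfDopingTP t₂ δ ∈ Icc a₂ b₂)
    (hχ₁ : IsRival χ₁) (hr₁ : KLRivalCeilingAtTP t₁ a₁ b₁ χ₁ r₁) (hl₁ : KLB1gFloorAtTP t₁ a₁ b₁ l₁)
    (hμ₁ : klMuOfDopingTP t₁ δ ∈ Icc a₁ b₁)
    (hχ₃ : IsRival χ₃) (hr₃ : KLRivalCeilingAtTP t₃ a₃ b₃ χ₃ r₃) (hl₃ : KLB1gFloorAtTP t₃ a₃ b₃ l₃)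
    (hμ₃ : klMuOfDopingTP t₃ δ ∈ Icc a₃ b₃)
    (hc₁ : r₁ - l₁ + g ≤ γ₂) (hc₃ : r₃ - l₃ + g ≤ γ₂) :
    LinePeakTP δ t₁ t₂ t₃ g := by
  have h2 := rivalMarginTP_ge_of_dominates hmid hμ₂
  have h1 := rivalMarginTP_le_of_dual hχ₁ hr₁ hl₁ hμ₁
  have h3 := rivalMarginTP_le_of_dual hχ₃ hr₃ hl₃ hμ₃
  exact ⟨by unfold lineMarginTP; linarith, by unfold lineMarginTP; linarith⟩

/-! ## §4  What a peak decides: neither monotone nor antitone -/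

/-- A strict interior drop `f x₃ + g ≤ f x₂`, `g > 0`, `x₂ ≤ x₃` excludes monotonicity on any set containing `x₂, x₃`. -/
theorem not_monotoneOn_of_peak {f : ℝ → ℝ} {s : Set ℝ} {x₂ x₃ g : ℝ} (h₂ : x₂ ∈ s) (h₃ : x₃ ∈ s) (h₂₃ : x₂ ≤ x₃)
    (hg : 0 < g) (hp : f x₃ + g ≤ f x₂) : ¬ MonotoneOn f s := by
  intro hm
  have := hm h₂ h₃ h₂₃
  linarith

/-- A strict interior rise `f x₁ + g ≤ f x₂`, `g > 0`, `x₁ ≤ x₂` excludes antitonicity on any set containing `x₁, x₂`. -/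
theorem not_antitoneOn_of_peak {f : ℝ → ℝ} {s : Set ℝ} {x₁ x₂ g : ℝ} (h₁ : x₁ ∈ s) (h₂ : x₂ ∈ s) (h₁₂ : x₁ ≤ x₂)
    (hg : 0 < g) (hp : f x₁ + g ≤ f x₂) : ¬ AntitoneOn f s := by
  intro hm
  have := hm h₁ h₂ h₁₂
  linarith

/-- **HQ1 (ii), negative form, from a peak row (PROVED).**  A certified peak of the margin at the levels of three dopings
`δ₁ ≤ δ₂ ≤ δ₃` at fixed `t′` makes `δ ↦ m(μ(δ; t′); t′)` NEITHER monotone NOR antitone on `[δ₁, δ₃]` — the certified counterexample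
to «the margin is monotone in `δ` at fixed `t′`».  No monotonicity of `δ ↦ μ(δ; t′)` is used. -/
theorem hq1ii_negative_of_marginPeak {tp δ₁ δ₂ δ₃ g : ℝ} (h₁₂ : δ₁ ≤ δ₂) (h₂₃ : δ₂ ≤ δ₃) (hg : 0 < g)
    (hp : MarginPeakTP tp (klMuOfDopingTP tp δ₁) (klMuOfDopingTP tp δ₂) (klMuOfDopingTP tp δ₃) g) :
    ¬ MonotoneOn (fun δ => rivalMarginTP tp (klMuOfDopingTP tp δ)) (Icc δ₁ δ₃) ∧
      ¬ AntitoneOn (fun δ => rivalMarginTP tp (klMuOfDopingTP tp δ)) (Icc δ₁ δ₃) := by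
  have hδ₁ : δ₁ ∈ Icc δ₁ δ₃ := ⟨le_rfl, h₁₂.trans h₂₃⟩
  have hδ₂ : δ₂ ∈ Icc δ₁ δ₃ := ⟨h₁₂, h₂₃⟩
  have hδ₃ : δ₃ ∈ Icc δ₁ δ₃ := ⟨h₁₂.trans h₂₃, le_rfl⟩
  exact ⟨not_monotoneOn_of_peak hδ₂ hδ₃ h₂₃ hg hp.2, not_antitoneOn_of_peak hδ₁ hδ₂ h₁₂ hg hp.1⟩

/-- **HQ1 (iii), the certifiable SHAPE of the line (PROVED)**: a certified peak along `t₃ ≤ t₂ ≤ t₁` at doping `δ` makes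
`t′ ↦ m(μ(δ; t′); t′)` neither monotone nor antitone on `[t₃, t₁]`.  HONEST SCOPE: together with positive floors at the three cells this
does NOT exclude a sign change of the margin BETWEEN audited cells (that needs a modulus of continuity in `t′`, not available: the kernel's
`t′`-derivative is not small, reader census r4 #13); what finitely many cells certify about (iii) is «no crossing AT the cells + a peak». -/
theorem hq1iii_shape_of_linePeak {δ t₁ t₂ t₃ g : ℝ} (h₃₂ : t₃ ≤ t₂) (h₂₁ : t₂ ≤ t₁) (hg : 0 < g)
    (hp : LinePeakTP δ t₁ t₂ t₃ g) :
    ¬ MonotoneOn (lineMarginTP δ) (Icc t₃ t₁) ∧ ¬ AntitoneOn (lineMarginTP δ) (Icc t₃ t₁) := by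
  have ht₁ : t₁ ∈ Icc t₃ t₁ := ⟨h₃₂.trans h₂₁, le_rfl⟩
  have ht₂ : t₂ ∈ Icc t₃ t₁ := ⟨h₃₂, h₂₁⟩
  have ht₃ : t₃ ∈ Icc t₃ t₁ := ⟨le_rfl, h₃₂.trans h₂₁⟩
  exact ⟨not_monotoneOn_of_peak ht₂ ht₁ h₂₁ hg hp.1, not_antitoneOn_of_peak ht₃ ht₂ h₃₂ hg hp.2⟩

/-! ## §5  The `λ_B1g`-only twin: the van Hove DIP of the `d`-wave coupling, from three `B1g`-sector words and no rival data -/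

/-- The `B1g` bottom of the `t`–`t′` band at `U = 1`: `λ_B1g(μ; t′) = channelInf ε_{t′} μ 1 B1g` (`< 0` = attraction in `d_{x²−y²}`). -/
def b1gBottomTP (tp μ : ℝ) : ℝ := channelInf (squareDispersion 1 tp) μ 1 D4Irrep.B1g

/-- **Interior dip of `λ_B1g`** (= interior PEAK of the `d`-wave coupling `−λ_B1g`): `λ_B1g(μ₂) + g ≤ λ_B1g(μ₁)` and `≤ λ_B1g(μ₃)`. [folklore] -/
def B1gDipTP (tp μ₁ μ₂ μ₃ g : ℝ) : Prop :=
  b1gBottomTP tp μ₂ + g ≤ b1gBottomTP tp μ₁ ∧ b1gBottomTP tp μ₂ + g ≤ b1gBottomTP tp μ₃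

/-- **Soundness of the dip leaf (PROVED)**: ONE `B1g` Ritz ceiling `u₂` on the middle box and TWO `B1g` floors `l₁, l₃` on the outer boxes
with `u₂ + g ≤ l₁`, `u₂ + g ≤ l₃` — three `B1g`-sector words, nothing about any other channel. -/
theorem b1gDipTP_of_records {tp μ₁ μ₂ μ₃ g a₁ b₁ a₂ b₂ a₃ b₃ u₂ l₁ l₃ : ℝ}
    (hu₂ : KLB1gCeilingAtTP tp a₂ b₂ u₂) (hμ₂ : μ₂ ∈ Icc a₂ b₂)
    (hl₁ : KLB1gFloorAtTP tp a₁ b₁ l₁) (hμ₁ : μ₁ ∈ Icc a₁ b₁)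
    (hl₃ : KLB1gFloorAtTP tp a₃ b₃ l₃) (hμ₃ : μ₃ ∈ Icc a₃ b₃)
    (hc₁ : u₂ + g ≤ l₁) (hc₃ : u₂ + g ≤ l₃) :
    B1gDipTP tp μ₁ μ₂ μ₃ g := by
  have h2 := hu₂ μ₂ hμ₂
  have h1 := hl₁ μ₁ hμ₁
  have h3 := hl₃ μ₃ hμ₃
  exact ⟨by unfold b1gBottomTP; linarith, by unfold b1gBottomTP; linarith⟩

/-- **Reading of a dip row (PROVED)**: the `d`-wave coupling `δ ↦ −λ_B1g(μ(δ; t′); t′)` is neither monotone nor antitone on `[δ₁, δ₃]`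
(«van Hove enhancement of the second-order `d`-wave coupling», as a certified three-point statement). -/
theorem dwaveCoupling_not_monotone_of_dip {tp δ₁ δ₂ δ₃ g : ℝ} (h₁₂ : δ₁ ≤ δ₂) (h₂₃ : δ₂ ≤ δ₃) (hg : 0 < g)
    (hp : B1gDipTP tp (klMuOfDopingTP tp δ₁) (klMuOfDopingTP tp δ₂) (klMuOfDopingTP tp δ₃) g) :
    ¬ MonotoneOn (fun δ => -b1gBottomTP tp (klMuOfDopingTP tp δ)) (Icc δ₁ δ₃) ∧
      ¬ AntitoneOn (fun δ => -b1gBottomTP tp (klMuOfDopingTP tp δ)) (Icc δ₁ δ₃) := by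
  have hδ₁ : δ₁ ∈ Icc δ₁ δ₃ := ⟨le_rfl, h₁₂.trans h₂₃⟩
  have hδ₂ : δ₂ ∈ Icc δ₁ δ₃ := ⟨h₁₂, h₂₃⟩
  have hδ₃ : δ₃ ∈ Icc δ₁ δ₃ := ⟨h₁₂.trans h₂₃, le_rfl⟩
  refine ⟨not_monotoneOn_of_peak hδ₂ hδ₃ h₂₃ hg ?_, not_antitoneOn_of_peak hδ₁ hδ₂ h₁₂ hg ?_⟩
  · show -b1gBottomTP tp (klMuOfDopingTP tp δ₃) + g ≤ -b1gBottomTP tp (klMuOfDopingTP tp δ₂)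
    have := hp.2
    linarith
  · show -b1gBottomTP tp (klMuOfDopingTP tp δ₁) + g ≤ -b1gBottomTP tp (klMuOfDopingTP tp δ₂)
    have := hp.1
    linarith

/-! ## §6  The three named target rows of the scan (statements only — NOTHING is claimed about them here) -/

/-- **Target row (ii)@`t′ = −1/5`**: the margin at `δ = 1/8` exceeds the margins at `δ = 1/20` and at `δ = 7/20` by some `g > 0`
(float orientation, not used: `m ≈ 0.287 / 0.504 / 0.098` at `N = 1024`, SCAN-TABLE v0 TABLE A). -/
def MarginPeakRow_tm02 : Prop :=
  ∃ g : ℝ, 0 < g ∧ MarginPeakTP (-1/5) (klMuOfDopingTP (-1/5) (1/20)) (klMuOfDopingTP (-1/5) (1/8)) (klMuOfDopingTP (-1/5) (7/20)) g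

/-- **Target line (iii)@`δ = 1/8`**: the margin at `t′ = −1/5` exceeds the margins at `t′ = 0` and at `t′ = −3/10` by some `g > 0`
(float orientation, not used: `m ≈ 0.245 / 0.504 / 0.240`). -/
def MarginPeakLine_d0125 : Prop :=
  ∃ g : ℝ, 0 < g ∧ LinePeakTP (1/8) 0 (-1/5) (-3/10) g

/-- **Target line, alternative middle node `t′ = −1/10`** (director successor #2 `(1/8, −1/10)`, a `Γ`-side admissible cell): the same
(iii)-line peak with nodes `t′ = 0, −1/10, −3/10` (float orientation, not used: margins `≈ 0.245 / 0.477 / 0.240`).  Whichever of the two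
successor cells is certified as a selection record can serve as the middle node. -/
def MarginPeakLine_d0125_tm01 : Prop :=
  ∃ g : ℝ, 0 < g ∧ LinePeakTP (1/8) 0 (-1/10) (-3/10) g

/-- **Target row, `d`-wave coupling only, @`t′ = −1/5`**: `λ_B1g` at `δ = 1/8` lies below `λ_B1g` at `δ = 1/20` and at `δ = 7/20` by some
`g > 0` (float orientation, not used: `λ_B1g ≈ −0.408 / −0.637 / −0.166`). -/
def B1gDipRow_tm02 : Prop :=
  ∃ g : ℝ, 0 < g ∧ B1gDipTP (-1/5) (klMuOfDopingTP (-1/5) (1/20)) (klMuOfDopingTP (-1/5) (1/8)) (klMuOfDopingTP (-1/5) (7/20)) g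

/-- **Reading (PROVED)**: the row `MarginPeakRow_tm02` answers HQ1 (ii) at `t′ = −1/5` in the negative — the margin is neither monotone
nor antitone in `δ` on `[1/20, 7/20]`. -/
theorem hq1ii_tm02_of_row (h : MarginPeakRow_tm02) :
    ¬ MonotoneOn (fun δ => rivalMarginTP (-1/5) (klMuOfDopingTP (-1/5) δ)) (Icc (1/20 : ℝ) (7/20)) ∧
      ¬ AntitoneOn (fun δ => rivalMarginTP (-1/5) (klMuOfDopingTP (-1/5) δ)) (Icc (1/20 : ℝ) (7/20)) := by
  obtain ⟨g, hg, hp⟩ := h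
  exact hq1ii_negative_of_marginPeak (by norm_num) (by norm_num) hg hp

/-- **Reading (PROVED)**: the line `MarginPeakLine_d0125` gives the certifiable shape of the (iii) line — the margin at `δ = 1/8` is neither
monotone nor antitone in `t′` on `[−3/10, 0]`. -/
theorem hq1iii_d0125_of_line (h : MarginPeakLine_d0125) :
    ¬ MonotoneOn (lineMarginTP (1/8)) (Icc (-3/10 : ℝ) 0) ∧ ¬ AntitoneOn (lineMarginTP (1/8)) (Icc (-3/10 : ℝ) 0) := by
  obtain ⟨g, hg, hp⟩ := h
  exact hq1iii_shape_of_linePeak (by norm_num) (by norm_num) hg hp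

/-- **Reading (PROVED)**: the alternative line `MarginPeakLine_d0125_tm01` gives the same shape conclusion on `[−3/10, 0]`. -/
theorem hq1iii_d0125_of_line_tm01 (h : MarginPeakLine_d0125_tm01) :
    ¬ MonotoneOn (lineMarginTP (1/8)) (Icc (-3/10 : ℝ) 0) ∧ ¬ AntitoneOn (lineMarginTP (1/8)) (Icc (-3/10 : ℝ) 0) := by
  obtain ⟨g, hg, hp⟩ := h
  exact hq1iii_shape_of_linePeak (by norm_num) (by norm_num) hg hp

/-- **Reading (PROVED)**: the row `B1gDipRow_tm02` certifies the van Hove enhancement of the `d`-wave coupling at `t′ = −1/5` as a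
three-point statement — `δ ↦ −λ_B1g` is neither monotone nor antitone on `[1/20, 7/20]`. -/
theorem dwave_tm02_of_row (h : B1gDipRow_tm02) :
    ¬ MonotoneOn (fun δ => -b1gBottomTP (-1/5) (klMuOfDopingTP (-1/5) δ)) (Icc (1/20 : ℝ) (7/20)) ∧
      ¬ AntitoneOn (fun δ => -b1gBottomTP (-1/5) (klMuOfDopingTP (-1/5) δ)) (Icc (1/20 : ℝ) (7/20)) := by
  obtain ⟨g, hg, hp⟩ := h
  exact dwaveCoupling_not_monotone_of_dip (by norm_num) (by norm_num) hg hp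

end Summit.HubbardSuperconductivity.HubbardSuperconductivity.Theorems.KlVHPeak

end
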